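import Summits.ValiantsHypothesis.ValiantsHypothesis.Theorems.LacunarySymmetroidMatrixDescartesCensusSpanTwoSector
import Summits.ValiantsHypothesis.ValiantsHypothesis.Theorems.LacunarySymmetroidMatrixDescartesCensusM2K5T14

/-!
# `MatrixDescartes` — span THREE escapes the span-two bound: the kernel witness at `(m, K) = (2, 5)`

HONEST FRAMING.  Object-search cell `pub-symmetroid`, crux `Theses.LacunarySymmetroid.MatrixDescartes`
(ledger item `stmt-ValiantsHypothesis-18050`; seat `val-sym-mdr-p1`).  Companion of `…CensusSpanTwoSector.lean`
(`Census.card_posRoots_spanTwo`: pencils whose coefficients span a PLANE of matrices have `Z₊ ≤ (m+1)(K−1)`).  This file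
makes the located ceiling «span three escapes» a kernel fact in the smallest format where it is visible: every real
symmetric `2 × 2` pencil has coefficient span `≤ 3` (`Sym₂(ℝ)` is three-dimensional: `S = a•E₁₁ + c•E₂₂ + b•(E₁₂+E₂₁)`),
and the census certificate `Census.M2K5T14.not_posRootLawAt` (`ζ_sym(2,5) ≥ 14`, tree) exhibits `14 > (2+1)(5−1) = 12`
positive zeros.  So the span-two theorem does NOT extend to span three with the same polynomial `(m+1)(K−1)`
(`not_spanThree_le`); whether span-three pencils obey SOME polynomial bound in `(m, K)` is open (at `m = 2` it is the
cell's `(2,K)` ladder question).  Nothing here bears on the crux itself, on `DoorA26`/`DoorA34`, or on `VP ≠ VNP`.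

[folklore] Elementary: decomposition of a symmetric `2 × 2` matrix in the basis `E₁₁, E₂₂, E₁₂+E₂₁` + the tree certificate.
-/

-- `Summit.ValiantsHypothesis.ValiantsHypothesis.…` repeats a component by the D-0017 layout
-- (single-conjunct summit), which the `dupNamespace` linter flags; the name is mandated.
set_option linter.dupNamespace false

namespace Summit.ValiantsHypothesis.ValiantsHypothesis.Theorems.LacunarySymmetroidMatrixDescartes.Census

open Summit.ValiantsHypothesis.ValiantsHypothesis.Theorems.MatrixDescartes.Negative (PosRootLawAt)
open scoped BigOperators Matrix
open Polynomial

/-- A real symmetric `2 × 2` matrix is a combination of `E₁₁`, `E₂₂` and `E₁₂ + E₂₁`. [folklore] -/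
theorem symm_two_eq_span_three (S : Matrix (Fin 2) (Fin 2) ℝ) (hS : S.IsSymm) :
    S = S 0 0 • !![(1 : ℝ), 0; 0, 0] + S 1 1 • !![(0 : ℝ), 0; 0, 1] + S 0 1 • !![(0 : ℝ), 1; 1, 0] := by
  have h10 : S 1 0 = S 0 1 := hS.apply 0 1
  ext i j
  fin_cases i <;> fin_cases j <;> simp [Matrix.add_apply, h10]

/-- **Span three escapes `(m+1)(K−1)`.**  It is NOT true that every `5`-term lacunary pencil of real `2 × 2` matrices
whose coefficients lie in a THREE-dimensional space of matrices has at most `(2+1)(5−1) = 12` distinct positive zeros of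
its determinant: the census witness of `ζ_sym(2,5) ≥ 14` (tree `Census.M2K5T14.not_posRootLawAt`) is symmetric, hence
of span `≤ 3`, with `14` positive zeros.  Contrast `Census.card_posRoots_spanTwo` (span two: `≤ 12` here). [folklore] -/
theorem not_spanThree_le :
    ¬ ∀ (d : Fin 5 → ℕ) (A B C : Matrix (Fin 2) (Fin 2) ℝ) (α β γ : Fin 5 → ℝ),
      ((Matrix.det (∑ l, ((X : ℝ[X]) ^ d l) • (α l • A + β l • B + γ l • C).map Polynomial.C)).roots.toFinset.filter
          (fun t => 0 < t)).card ≤ (2 + 1) * (5 - 1) := by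
  intro h
  apply M2K5T14.not_posRootLawAt
  intro d S hS
  have e : S = fun l => S l 0 0 • !![(1 : ℝ), 0; 0, 0] + S l 1 1 • !![(0 : ℝ), 0; 0, 1] +
      S l 0 1 • !![(0 : ℝ), 1; 1, 0] := funext fun l => symm_two_eq_span_three (S l) (hS l)
  have h1 := h d !![(1 : ℝ), 0; 0, 0] !![(0 : ℝ), 0; 0, 1] !![(0 : ℝ), 1; 1, 0]
    (fun l => S l 0 0) (fun l => S l 1 1) (fun l => S l 0 1)
  rw [e]
  exact h1.trans (by norm_num)

end Summit.ValiantsHypothesis.ValiantsHypothesis.Theorems.LacunarySymmetroidMatrixDescartes.Census
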